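import Literature.NumberTheory.Automorphic.Sweep2
import HarnessLib

/-!
# Langlands functoriality `GL_m → GL_n` (lang.S04): status of the named fact and two formal consequences

`Literature.NumberTheory.Automorphic.FunctorialityGLConjecture m n K hm hn` (`Sweep2`) is the weak
(Satake, (F1)) form of Langlands' functoriality principle for an algebraic homomorphism
`r : GL_m(ℂ) → GL_n(ℂ)` over a number field `K`: Langlands, *Problems in the theory of
automorphic forms* (1970), §7, Question 5 (global form of Question 4; "My hope is that all these
questions have affirmative answers"); Borel, *Automorphic L-functions* (Corvallis 1979), §17.2;
Getz–Hahn, GTM 300 (2024), Conjecture 7.7.1. It is an OPEN CONJECTURE, vendored as a named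
`def` (CONVENTIONS §4: open conjectures are `def … : Prop`, never theorems), and it has no
discharge `FunctorialityGLConjecture_holds`: its universal closure contains, for instance, the
automorphy of a weak transfer `Sym⁵ π` for every automorphic representation `π` of `GL_2(𝔸_K)`
(`m = 2`, `n = 6`, `r = Sym⁵`), which is unproven — `Symᵏ : GL_2 → GL_{k+1}` is known for `k ≤ 4`
only (Gelbart–Jacquet, Kim–Shahidi, Kim; Getz–Hahn 2024, Thm. 13.6.1 and the remark following it:
"the corresponding statement for `k ≥ 5` remains unproven"; §13.1: "for number fields the
conjecture remains mostly open").

This file records, sorry-free, two elementary formal consequences that locate the fact inside the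
library (they are remarks on the Lean statement, tagged `[folklore]`):

* `FunctorialityGLConjecture.hasSatakeParamAt_cofinite`: the conjecture with ANY target rank `n`,
  applied to the trivial homomorphism `r = 1` (algebraic: `MonoidHom.isAlgebraicGL_one`), already
  yields the named fact `AutomorphicRepData.hasSatakeParamAt_cofinite π` (`AutomorphicRepsGL`;
  Flath 1979, Thm. 3; Borel–Jacquet 1979, 4.6: automorphic representations are unramified at
  almost all places) for every automorphic representation `π` of `GL_m(𝔸_K)`. So no instance of
  the fact — not even `n = 0` — is provable before that fact is discharged.
* `FunctorialityGLConjecture.exists_hasSatakeParamAt_replicate_one`: again with `r = 1`, the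
  conjecture produces from any automorphic representation of `GL_m(𝔸_K)` (for `m = 0`: of the
  trivial group `GL_0(𝔸_K)`) an automorphic representation of `GL_n(𝔸_K)` whose Satake class is
  `{1, …, 1}` at almost every finite place (`transferSatakeClass_one`: the transfer of any class
  along `r = 1` is the class of the identity). This is Langlands' own first illustration of the
  depth of Question 5 (1970, §7, the discussion following Question 5, the case of the trivial
  group `G'' = {1}`): the predicted space of automorphic forms "is not the space of constant
  functions. To prove its existence will require the theory of Eisenstein series" (for `n ≥ 2`
  the constants on `GL_n(𝔸_K)` have Satake class `{q_v^{-(n-1)/2}, …, q_v^{(n-1)/2}} ≠ {1, …, 1}`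
  in the normalisation of `HasSatakeParamAt`).

## References

* R. P. Langlands, *Problems in the theory of automorphic forms*, LNM 170 (1970), 18–61, §7.
* A. Borel, *Automorphic L-functions*, Proc. Sympos. Pure Math. 33 (1979), part 2, 27–61, §§16–17.
* J. R. Getz, H. Hahn, *An Introduction to Automorphic Representations*, GTM 300 (2024),
  Conj. 7.7.1, §13.1, Thm. 13.6.1.
* D. Flath, *Decomposition of representations into tensor products*, Corvallis 1979, Thm. 3.
-/

noncomputable section

open scoped MatrixGroups Polynomial Classical
open NumberField IsDedekindDomain

namespace Literature.NumberTheory.Automorphic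

open Literature.NumberTheory.Automorphic

/-! ### The trivial homomorphism is algebraic; its Satake transfer is the class of the identity -/

section Trivial

variable {k : Type*} [Field k] {ι : Type*} [Fintype ι] [DecidableEq ι]
  {κ : Type*} [Fintype κ] [DecidableEq κ]

/-- The trivial homomorphism `g ↦ 1` from a subgroup `G ≤ GL ι k` to `GL κ k` is algebraic: every
coordinate of `1` is a constant polynomial (Springer, *Linear Algebraic Groups*, 2.1.1–2.2.1). [folklore] -/
theorem MonoidHom.isAlgebraicGL_one {G : Subgroup (GL ι k)} :
    (1 : ↥G →* GL κ k).IsAlgebraicGL :=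
  ⟨fun c => MvPolynomial.C (glCoordFun (1 : GL κ k) c), fun g c => by
    rw [MonoidHom.one_apply, MvPolynomial.eval_C]⟩

end Trivial

section Transfer

variable (m n : ℕ)

/-- Along the trivial homomorphism `r = 1 : GL_m(ℂ) → GL_n(ℂ)` every Satake class is sent to the
class of the identity, `{1, …, 1}` (`n` times): the characteristic polynomial of `1 ∈ GL_n(ℂ)`
is `(X - 1)ⁿ`. [folklore] -/
theorem transferSatakeClass_one (d : Fin m → ℂˣ) :
    transferSatakeClass m n 1 d = Multiset.replicate n 1 := by
  unfold transferSatakeClass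
  rw [MonoidHom.one_apply, Units.val_one, Matrix.charpoly_one, Fintype.card_fin, ← Polynomial.C_1,
    Polynomial.roots_pow, Polynomial.roots_X_sub_C, Multiset.nsmul_singleton]

/-- The algebraicity hypothesis of `FunctorialityGLConjecture` holds for `r = 1`. [folklore] -/
theorem isAlgebraicGL_one_comp_subtype :
    ((1 : GL (Fin m) ℂ →* GL (Fin n) ℂ).comp
      (⊤ : Subgroup (GL (Fin m) ℂ)).subtype).IsAlgebraicGL := by
  rw [MonoidHom.one_comp]
  exact MonoidHom.isAlgebraicGL_one

end Transfer

/-! ### Formal consequences of the conjecture -/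

section Consequences

variable {m n : ℕ} {K : Type} [Field K] [NumberField K]
  {hm : isCompact_glFiniteIntegralLevel m K} {hn : isCompact_glFiniteIntegralLevel n K}

/-- **Functoriality (any target rank) contains unramifiedness almost everywhere.** If
`FunctorialityGLConjecture m n K hm hn` holds, then every automorphic representation `π` of
`GL_m(𝔸_K)` is unramified at all but finitely many finite places, i.e. the named fact
`π.hasSatakeParamAt_cofinite` (Flath 1979, Thm. 3; Borel–Jacquet 1979, 4.6) holds for `π`:
apply the conjecture to the (algebraic) trivial homomorphism `r = 1`; a weak transfer
`IsFunctorialTransferGL` in particular exhibits a Satake parameter of `π` at almost every `v`. [folklore] -/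
theorem FunctorialityGLConjecture.hasSatakeParamAt_cofinite
    (h : FunctorialityGLConjecture m n K hm hn)
    (π : AutomorphicRepData (AutomorphyDatum.gl m K hm)) : π.hasSatakeParamAt_cofinite := by
  obtain ⟨_, hπ'⟩ := h 1 (isAlgebraicGL_one_comp_subtype m n) π
  exact hπ'.mono fun v ⟨d, hd, _⟩ => ⟨_, hd⟩

/-- **Functoriality along `r = 1` predicts the Satake class of the identity.** If
`FunctorialityGLConjecture m n K hm hn` holds, every automorphic representation `π` of
`GL_m(𝔸_K)` has a companion automorphic representation `Π` of `GL_n(𝔸_K)` with Satake class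
`{1, …, 1}` at almost every finite place (the class of the spherical constituent of the
unramified principal series `Ind(1)`, realised globally by Eisenstein series — Langlands 1970,
§7, discussion after Question 5; for `m = 0` this is literally Langlands' example of the trivial
group `G'' = {1}`). [folklore] -/
theorem FunctorialityGLConjecture.exists_hasSatakeParamAt_replicate_one
    (h : FunctorialityGLConjecture m n K hm hn)
    (π : AutomorphicRepData (AutomorphyDatum.gl m K hm)) :
    ∃ π' : AutomorphicRepData (AutomorphyDatum.gl n K hn),
      ∀ᶠ v in Filter.cofinite, π'.HasSatakeParamAt v (Multiset.replicate n 1) := by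
  obtain ⟨π', hπ'⟩ := h 1 (isAlgebraicGL_one_comp_subtype m n) π
  refine ⟨π', hπ'.mono fun v ⟨d, _, hd⟩ => ?_⟩
  rwa [transferSatakeClass_one] at hd

end Consequences

end Literature.NumberTheory.Automorphic
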